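import Summits.Ventures.HodgeRepro2.Hypothesis

/-!
# HodgeRepro2 — neat congruence subgroups (statement shapes)

Blind re-derivation cell `pub-hodge-repro2`, seat p2 (file 8; imports `Hypothesis.lean`).

The canonical models and the Albanese theorem are stated for "sufficiently small" (neat) levels:
[Liu21] Y. Liu, Cambridge J. Math. 9 (2021), p. 45: "indexed by sufficiently small open compact
subgroups `K`"; BMM §1.4: "We will always choose `K` to be neat".  The printed definition and the
printed explicit neat level are in [DR15] Dimitrov–Ramakrishnan, Doc. Math. 20 (2015):
* §1, proof of Lemma 1.1 (QUOTE): "Recall that `Γ` is neat if the subgroup of `ℂ^×` generated by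
  the eigenvalues of any `γ ∈ Γ` is torsion-free. In particular `Γ` is torsion-free."
* Lemma 1.1 (QUOTE): "`Γ` neat ⇒ `Γ` torsion-free ⇒ `Γ̄` torsion-free ⇒ `Y_Γ` is a hyperbolic
  manifold."
* Lemma 1.4 (QUOTE): "For any integer `N > 2` the group `Γ(N)` is neat." (with the reference
  [holzapfel]); Lemma 1.5: for `M` imaginary quadratic of discriminant `−D ∉ {−3,−4,−7,−8,−24}`,
  `Γ₁(√−D 𝔒)` is neat.

Here: `eigenvalueUnits`, `IsNeat` (the definition, eigenvalues read through a complex embedding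
`τ`), `IsTorsionFreeSet`, and the shapes `DR15Lemma14Shape` (Lemma 1.4) and
`NeatImpliesTorsionFree` (the first implication of Lemma 1.1) as `Prop`s.
-/

namespace Summit.Ventures.HodgeRepro2.ShimuraData

open NumberField

noncomputable section

variable (K : Type*) [Field K] [NumberField K] [IsCMField K] {m : ℕ}

/-- The eigenvalues of `τ(γ)` (roots of its characteristic polynomial), as units of `ℂ`. -/
def eigenvalueUnits (τ : K →+* ℂ) (γ : GL (Fin m) K) : Set ℂˣ :=
  {z | (z : ℂ) ∈ ((γ : Matrix (Fin m) (Fin m) K).map τ).charpoly.roots}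

/-- [DR15] §1: "`Γ` is neat if the subgroup of `ℂ^×` generated by the eigenvalues of any `γ ∈ Γ`
is torsion-free" — eigenvalues taken through the complex embedding `τ` (any `τ` gives the same
condition, the eigenvalues being algebraic and the condition Galois-invariant). -/
def IsNeat (τ : K →+* ℂ) (Γ : Set (GL (Fin m) K)) : Prop :=
  ∀ γ ∈ Γ, ∀ z ∈ Subgroup.closure (eigenvalueUnits K τ γ), ∀ n : ℕ, 0 < n → z ^ n = 1 → z = 1

/-- A subset of `GL_m(K)` is torsion-free: no element of finite order other than `1`. -/
def IsTorsionFreeSet (Γ : Set (GL (Fin m) K)) : Prop :=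
  ∀ γ ∈ Γ, ∀ n : ℕ, 0 < n → γ ^ n = 1 → γ = 1

/-- [DR15] Lemma 1.4, as a statement shape: for every integer `N > 2` the principal congruence
subgroup `Γ(N)` (of level the ideal `N 𝓞_K`, [DR15] Def. 1.3) is neat. -/
def DR15Lemma14Shape (τ : K →+* ℂ) (H : Matrix (Fin m) (Fin m) K) : Prop :=
  ∀ N : ℕ, 2 < N → IsNeat K τ (principalCongruence K H (Ideal.span {(N : 𝓞 K)}))

/-- [DR15] Lemma 1.1, first implication, as a statement shape: neat implies torsion-free. -/
def NeatImpliesTorsionFree (τ : K →+* ℂ) : Prop :=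
  ∀ Γ : Set (GL (Fin m) K), IsNeat K τ Γ → IsTorsionFreeSet K Γ

end

end Summit.Ventures.HodgeRepro2.ShimuraData
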